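import Mathlib

/-!
# `RationalPeriodQuarter` — one-sided limits of determinant-one real Möbius maps (child A, lemma L3, Möbius part)

Support for `RationalPeriodQuarter.HeckeFieldOfCruxes` (stmt-Langlands-10432).  For `m t = (a t + b)/(c t + d)` with
`a d - b c = 1`: `m` maps `𝓝[>] x → 𝓝[>] (m x)` and `𝓝[<] x → 𝓝[<] (m x)` at regular points, tends to `∓∞` at the
pole from the right/left, to `(a/c)^∓` at `±∞` when `c ≠ 0`, and is a translation when `c = 0`.  Mathlib only.
-/

set_option linter.dupNamespace false

namespace Summit.Langlands.Langlands.Theorems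

open scoped BigOperators Topology
open Filter Set Polynomial

/-- Difference formula for a determinant-one real Möbius map. -/
theorem rpq_moebius_sub (a b c d : ℝ) (hdet : a * d - b * c = 1) (t x : ℝ) (ht : c * t + d ≠ 0)
    (hx : c * x + d ≠ 0) :
    (a * t + b) / (c * t + d) - (a * x + b) / (c * x + d) = (t - x) / ((c * t + d) * (c * x + d)) := by
  rw [div_sub_div _ _ ht hx, div_eq_div_iff (mul_ne_zero ht hx) (mul_ne_zero ht hx)]
  linear_combination (t - x) * ((c * t + d) * (c * x + d)) * hdet

/-- M1 (right): at a regular point a determinant-one Möbius map sends `𝓝[>] x` to `𝓝[>] (m x)`. -/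
theorem rpq_moebius_tendsto_nhdsGT (a b c d : ℝ) (hdet : a * d - b * c = 1) (x : ℝ) (hx : c * x + d ≠ 0) :
    Tendsto (fun t : ℝ => (a * t + b) / (c * t + d)) (𝓝[>] x) (𝓝[>] ((a * x + b) / (c * x + d))) := by
  have hcont : ContinuousAt (fun t : ℝ => (a * t + b) / (c * t + d)) x :=
    ((continuous_const.mul continuous_id).add continuous_const).continuousAt.div
      ((continuous_const.mul continuous_id).add continuous_const).continuousAt hx
  rw [tendsto_nhdsWithin_iff]
  refine ⟨hcont.tendsto.mono_left nhdsWithin_le_nhds, ?_⟩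
  have hpos : ∀ᶠ (t : ℝ) in 𝓝 x, 0 < (c * t + d) * (c * x + d) := by
    have hc2 : ContinuousAt (fun t : ℝ => (c * t + d) * (c * x + d)) x :=
      (((continuous_const.mul continuous_id).add continuous_const).mul continuous_const).continuousAt
    exact hc2.tendsto.eventually_const_lt (mul_self_pos.2 hx)
  filter_upwards [mem_nhdsWithin_of_mem_nhds hpos, self_mem_nhdsWithin] with t ht hgt
  have hct : c * t + d ≠ 0 := by
    intro h0; rw [h0, zero_mul] at ht; exact lt_irrefl _ ht
  rw [Set.mem_Ioi, ← sub_pos, rpq_moebius_sub a b c d hdet t x hct hx]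
  exact div_pos (sub_pos.2 hgt) ht

/-- M1 (left): at a regular point a determinant-one Möbius map sends `𝓝[<] x` to `𝓝[<] (m x)`. -/
theorem rpq_moebius_tendsto_nhdsLT (a b c d : ℝ) (hdet : a * d - b * c = 1) (x : ℝ) (hx : c * x + d ≠ 0) :
    Tendsto (fun t : ℝ => (a * t + b) / (c * t + d)) (𝓝[<] x) (𝓝[<] ((a * x + b) / (c * x + d))) := by
  have hcont : ContinuousAt (fun t : ℝ => (a * t + b) / (c * t + d)) x :=
    ((continuous_const.mul continuous_id).add continuous_const).continuousAt.div
      ((continuous_const.mul continuous_id).add continuous_const).continuousAt hx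
  rw [tendsto_nhdsWithin_iff]
  refine ⟨hcont.tendsto.mono_left nhdsWithin_le_nhds, ?_⟩
  have hpos : ∀ᶠ (t : ℝ) in 𝓝 x, 0 < (c * t + d) * (c * x + d) := by
    have hc2 : ContinuousAt (fun t : ℝ => (c * t + d) * (c * x + d)) x :=
      (((continuous_const.mul continuous_id).add continuous_const).mul continuous_const).continuousAt
    exact hc2.tendsto.eventually_const_lt (mul_self_pos.2 hx)
  filter_upwards [mem_nhdsWithin_of_mem_nhds hpos, self_mem_nhdsWithin] with t ht hlt
  have hct : c * t + d ≠ 0 := by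
    intro h0; rw [h0, zero_mul] at ht; exact lt_irrefl _ ht
  rw [Set.mem_Iio, ← sub_neg, rpq_moebius_sub a b c d hdet t x hct hx]
  exact div_neg_of_neg_of_pos (sub_neg.2 hlt) ht

/-- Pole form of a determinant-one Möbius map: `m t = a/c - 1/(c (c t + d))`. -/
theorem rpq_moebius_pole_form (a b c d : ℝ) (hdet : a * d - b * c = 1) (hc : c ≠ 0) (t : ℝ)
    (ht : c * t + d ≠ 0) : (a * t + b) / (c * t + d) = a / c - (c * (c * t + d))⁻¹ := by
  have h1 : c * (c * t + d) ≠ 0 := mul_ne_zero hc ht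
  rw [inv_eq_one_div, div_sub_div _ _ hc h1, div_eq_div_iff ht (mul_ne_zero hc h1)]
  linear_combination (-(c * (c * t + d))) * hdet

/-- M2 (right of the pole): `m t → -∞` as `t → x⁺` when `c x + d = 0`. -/
theorem rpq_moebius_tendsto_pole_GT (a b c d : ℝ) (hdet : a * d - b * c = 1) (hc : c ≠ 0) (x : ℝ)
    (hx : c * x + d = 0) : Tendsto (fun t : ℝ => (a * t + b) / (c * t + d)) (𝓝[>] x) atBot := by
  have hd : d = -(c * x) := by linarith
  have hg : Tendsto (fun t : ℝ => c * (c * t + d)) (𝓝[>] x) (𝓝[>] 0) := by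
    rw [tendsto_nhdsWithin_iff]
    constructor
    · have : Tendsto (fun t : ℝ => c * (c * t + d)) (𝓝 x) (𝓝 (c * (c * x + d))) :=
        (continuous_const.mul ((continuous_const.mul continuous_id).add continuous_const)).continuousAt
      rw [hx, mul_zero] at this
      exact this.mono_left nhdsWithin_le_nhds
    · filter_upwards [self_mem_nhdsWithin] with t ht
      rw [Set.mem_Ioi] at ht ⊢
      have : c * (c * t + d) = c ^ 2 * (t - x) := by rw [hd]; ring
      rw [this]; positivity
  have hinv : Tendsto (fun t : ℝ => (c * (c * t + d))⁻¹) (𝓝[>] x) atTop := hg.inv_tendsto_nhdsGT_zero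
  have hneg : Tendsto (fun t : ℝ => a / c + -(c * (c * t + d))⁻¹) (𝓝[>] x) atBot :=
    tendsto_atBot_add_const_left _ _ (tendsto_neg_atTop_atBot.comp hinv)
  refine hneg.congr' ?_
  filter_upwards [self_mem_nhdsWithin] with t ht
  have hct : c * t + d ≠ 0 := by
    rw [hd]; intro h0
    have : c * (t - x) = 0 := by linarith
    rcases mul_eq_zero.1 this with h | h
    · exact hc h
    · exact (ne_of_gt (Set.mem_Ioi.1 ht)) (by linarith)
  rw [rpq_moebius_pole_form a b c d hdet hc t hct, sub_eq_add_neg]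

/-- M2 (left of the pole): `m t → +∞` as `t → x⁻` when `c x + d = 0`. -/
theorem rpq_moebius_tendsto_pole_LT (a b c d : ℝ) (hdet : a * d - b * c = 1) (hc : c ≠ 0) (x : ℝ)
    (hx : c * x + d = 0) : Tendsto (fun t : ℝ => (a * t + b) / (c * t + d)) (𝓝[<] x) atTop := by
  have hd : d = -(c * x) := by linarith
  have hg : Tendsto (fun t : ℝ => c * (c * t + d)) (𝓝[<] x) (𝓝[<] 0) := by
    rw [tendsto_nhdsWithin_iff]
    constructor
    · have : Tendsto (fun t : ℝ => c * (c * t + d)) (𝓝 x) (𝓝 (c * (c * x + d))) :=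
        (continuous_const.mul ((continuous_const.mul continuous_id).add continuous_const)).continuousAt
      rw [hx, mul_zero] at this
      exact this.mono_left nhdsWithin_le_nhds
    · filter_upwards [self_mem_nhdsWithin] with t ht
      rw [Set.mem_Iio] at ht ⊢
      have : c * (c * t + d) = -(c ^ 2 * (x - t)) := by rw [hd]; ring
      rw [this, neg_lt_zero]
      have : 0 < x - t := by linarith
      positivity
  have hinv : Tendsto (fun t : ℝ => (c * (c * t + d))⁻¹) (𝓝[<] x) atBot :=
    tendsto_inv_nhdsLT_zero.comp hg
  have hneg : Tendsto (fun t : ℝ => a / c + -(c * (c * t + d))⁻¹) (𝓝[<] x) atTop :=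
    tendsto_atTop_add_const_left _ _ (tendsto_neg_atBot_atTop.comp hinv)
  refine hneg.congr' ?_
  filter_upwards [self_mem_nhdsWithin] with t ht
  have hct : c * t + d ≠ 0 := by
    rw [hd]; intro h0
    have : c * (t - x) = 0 := by linarith
    rcases mul_eq_zero.1 this with h | h
    · exact hc h
    · exact (ne_of_lt (Set.mem_Iio.1 ht)) (by linarith)
  rw [rpq_moebius_pole_form a b c d hdet hc t hct, sub_eq_add_neg]

/-- M3 (`+∞`): for `c ≠ 0`, `m t → (a/c)⁻` as `t → +∞`. -/
theorem rpq_moebius_tendsto_atTop (a b c d : ℝ) (hdet : a * d - b * c = 1) (hc : c ≠ 0) :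
    Tendsto (fun t : ℝ => (a * t + b) / (c * t + d)) atTop (𝓝[<] (a / c)) := by
  have hg : Tendsto (fun t : ℝ => c * (c * t + d)) atTop atTop := by
    have : Tendsto (fun t : ℝ => c ^ 2 * t + c * d) atTop atTop :=
      tendsto_atTop_add_const_right _ _ (Tendsto.const_mul_atTop (by positivity) tendsto_id)
    refine this.congr fun t => by ring
  have hinv : Tendsto (fun t : ℝ => (c * (c * t + d))⁻¹) atTop (𝓝 0) := hg.inv_tendsto_atTop
  have hct : ∀ᶠ (t : ℝ) in atTop, 0 < c * (c * t + d) := hg.eventually_gt_atTop 0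
  rw [tendsto_nhdsWithin_iff]
  constructor
  · have h2 : Tendsto (fun t : ℝ => a / c - (c * (c * t + d))⁻¹) atTop (𝓝 (a / c - 0)) :=
      tendsto_const_nhds.sub hinv
    rw [sub_zero] at h2
    refine h2.congr' ?_
    filter_upwards [hct] with t ht
    have hne : c * t + d ≠ 0 := by
      intro h0; rw [h0, mul_zero] at ht; exact lt_irrefl _ ht
    rw [rpq_moebius_pole_form a b c d hdet hc t hne]
  · filter_upwards [hct] with t ht
    have hne : c * t + d ≠ 0 := by
      intro h0; rw [h0, mul_zero] at ht; exact lt_irrefl _ ht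
    rw [Set.mem_Iio, rpq_moebius_pole_form a b c d hdet hc t hne, sub_lt_self_iff]
    positivity

/-- M3 (`-∞`): for `c ≠ 0`, `m t → (a/c)⁺` as `t → -∞`. -/
theorem rpq_moebius_tendsto_atBot (a b c d : ℝ) (hdet : a * d - b * c = 1) (hc : c ≠ 0) :
    Tendsto (fun t : ℝ => (a * t + b) / (c * t + d)) atBot (𝓝[>] (a / c)) := by
  have hg : Tendsto (fun t : ℝ => c * (c * t + d)) atBot atBot := by
    have : Tendsto (fun t : ℝ => c ^ 2 * t + c * d) atBot atBot :=
      tendsto_atBot_add_const_right _ _ (Tendsto.const_mul_atBot (by positivity) tendsto_id)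
    refine this.congr fun t => by ring
  have hinv : Tendsto (fun t : ℝ => (c * (c * t + d))⁻¹) atBot (𝓝 0) := tendsto_inv_atBot_zero.comp hg
  have hct : ∀ᶠ (t : ℝ) in atBot, c * (c * t + d) < 0 := hg.eventually_lt_atBot 0
  rw [tendsto_nhdsWithin_iff]
  constructor
  · have h2 : Tendsto (fun t : ℝ => a / c - (c * (c * t + d))⁻¹) atBot (𝓝 (a / c - 0)) :=
      tendsto_const_nhds.sub hinv
    rw [sub_zero] at h2
    refine h2.congr' ?_
    filter_upwards [hct] with t ht
    have hne : c * t + d ≠ 0 := by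
      intro h0; rw [h0, mul_zero] at ht; exact lt_irrefl _ ht
    rw [rpq_moebius_pole_form a b c d hdet hc t hne]
  · filter_upwards [hct] with t ht
    have hne : c * t + d ≠ 0 := by
      intro h0; rw [h0, mul_zero] at ht; exact lt_irrefl _ ht
    rw [Set.mem_Ioi, rpq_moebius_pole_form a b c d hdet hc t hne, lt_sub_iff_add_lt, add_lt_iff_neg_left]
    exact inv_lt_zero.2 ht

/-- M4: for `c = 0` (so `a = d = ±1`), `m t → +∞` as `t → +∞` and `m t → -∞` as `t → -∞`. -/
theorem rpq_moebius_tendsto_translation (a b c d : ℝ) (hc : c = 0) (had : (a = 1 ∧ d = 1) ∨ (a = -1 ∧ d = -1)) :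
    Tendsto (fun t : ℝ => (a * t + b) / (c * t + d)) atTop atTop ∧
      Tendsto (fun t : ℝ => (a * t + b) / (c * t + d)) atBot atBot := by
  subst hc
  have key : ∀ t : ℝ, (a * t + b) / (0 * t + d) = t + b / d := by
    intro t
    rcases had with ⟨ha, hd⟩ | ⟨ha, hd⟩ <;> subst ha <;> subst hd <;> ring
  simp_rw [key]
  exact ⟨tendsto_atTop_add_const_right _ _ tendsto_id, tendsto_atBot_add_const_right _ _ tendsto_id⟩

end Summit.Langlands.Langlands.Theorems
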